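import Mathlib.Analysis.Normed.Ring.InfiniteSum
import Mathlib.Analysis.Complex.Basic
import Literature.NumberTheory.Weil1964.ThetaDistribution
import HarnessLib

/-!
# Weil 1964, n° 41: the theta series `Θ(S) = Σ_{ξ ∈ X_k} (SΦ)(ξ)` as a DEFINITION over an evaluation model, and
# its multiplicativity over a direct sum `X = X₁ ⊕ X₂` (theta kernels of pure tensors multiply) — proved

A. Weil, *Sur certains groupes d'opérateurs unitaires*, Acta Math. 111 (1964) 143–211 [Weil1964], Chap. III n° 41,
THÉORÈME 6, p. 193 (held `paper:doi-10-1007-bf02391012`, printed page = PDF page + 142, p0051 L24–29; the OCR of the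
display is checked against the sentence): "Soient `X_k` un espace vectoriel de dimension finie sur `k`, et `Φ` une
fonction appartenant à `S(X_A)`.  Soit `Θ` la fonction sur `Mp(X)_A`, définie, pour tout `S ∈ Mp(X)_A`, par la
formule `Θ(S) = Σ_{ξ ∈ X_k} SΦ(ξ)`.  Alors `Θ` est une fonction continue sur `Mp(X)_A`, invariante par les
translations à gauche déterminées par les éléments de `Mp(X)_A` de la forme `r_k(s)`, avec `s ∈ Ps(X)_k`."
(The continuity/invariance CONCLUSION is the typed skeleton `WeilThetaDatum.ThetaContinuousInvariant` of
`Literature/NumberTheory/Weil1964/ThetaDistribution.lean`; this module concerns the DEFINING FORMULA.)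

WHAT IS HERE.  (1) Over a bare-carrier `ThetaSeriesDatum Mp SX Xk` (parameter types for `Mp(X)_A`, `S(X_A)` and the
set of rational points `X_k`; fields: the action `(S, Φ) ↦ SΦ` and the evaluation `Φ ↦ (ξ ↦ Φ(ξ))` on rational
points) the theta series is DEFINED by Weil's formula, `thetaSeries D Φ S := ∑' ξ, (SΦ)(ξ)` (Mathlib `tsum`; junk
value `0` when the family is not summable — for `Φ ∈ S(X_A)` Weil proves absolute convergence in the course of n° 41,
Lemme 5, so the junk case is outside print's hypotheses), and `toWeilThetaDatum` packages it as the tree's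
`WeilThetaDatum`.  (2) PROVED (`thetaSeries_pair`): for `X = X₁ ⊕ X₂` — rational points `X_k = X_{1,k} × X_{2,k}`,
pure tensors `Φ₁ ⊗ Φ₂ ∈ S(X_A)` with `(Φ₁ ⊗ Φ₂)(ξ₁, ξ₂) = Φ₁(ξ₁)Φ₂(ξ₂)`, and an element `j̃(S₁, S₂)` of `Mp(X)_A`
acting on pure tensors factorwise (the content of [MoeglinVignerasWaldspurger1987, Chap. 2 II.1 Rem. (6)] /
`MetaplecticSumDatum.WeilRepMultiplicative`, here as an explicit hypothesis on the given elements) — the theta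
series MULTIPLY: `Θ_{Φ₁⊗Φ₂}(j̃(S₁,S₂)) = Θ_{Φ₁}(S₁) · Θ_{Φ₂}(S₂)`, granted absolute convergence of the two factor
series (`tsum_mul_tsum_of_summable_norm`).  All hypotheses are explicit arguments; nothing is asserted.

NOT here: `S(X_A)`, `Mp(X)_A`, convergence (Weil's Lemme 5), continuity and invariance (Thm 6's conclusion — see
`ThetaDistribution.lean`), the identification `S(X_A) = S(X_{1,A}) ⊗̂ S(X_{2,A})`.

## References

* [Weil1964] A. Weil, Acta Math. 111 (1964), Chap. III n° 41, Théorème 6, p. 193.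
* [MoeglinVignerasWaldspurger1987] MVW, LNM 1291, Chap. 2 II.1 Rem. (6) (`ω_ψ ∘ j ≃ ω_{ψ,1} ⊠ ω_{ψ,2}`).
-/

namespace Literature.NumberTheory.Weil1964

open scoped BigOperators

universe u v w

/-- **Carriers for Weil's theta series** [Weil1964, Chap. III n° 41, Thm 6, p. 193]: parameter types `Mp` for
`Mp(X)_A`, `SX` for `S(X_A)`, `Xk` for the rational points `X_k ⊂ X_A`; fields: the action `(S, Φ) ↦ SΦ` of
`Mp(X)_A` on `S(X_A)` and the evaluation of a function of `S(X_A)` at the rational points.  A hypothesis structure: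
nothing is asserted. [cite: Weil1964, Chap. III n° 41, Thm 6 p. 193] -/
structure ThetaSeriesDatum (Mp : Type u) (SX : Type v) (Xk : Type w) where
  /-- `(S, Φ) ↦ SΦ` -/
  act : Mp → SX → SX
  /-- `Φ ↦ (ξ ↦ Φ(ξ))`, `ξ ∈ X_k` -/
  ev : SX → Xk → ℂ

namespace ThetaSeriesDatum

variable {Mp : Type u} {SX : Type v} {Xk : Type w}

/-- **Weil's theta series**, AS PRINTED [Weil1964, n° 41, Thm 6, p. 193]: "Soit `Θ` la fonction sur `Mp(X)_A`,
définie, pour tout `S ∈ Mp(X)_A`, par la formule `Θ(S) = Σ_{ξ ∈ X_k} SΦ(ξ)`."  TYPING: Mathlib's `tsum` over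
`X_k` (junk value `0` off the summable locus, which for `Φ ∈ S(X_A)` is empty by Weil's Lemme 5).
[cite: Weil1964, Chap. III n° 41, Thm 6 p. 193] -/
noncomputable def thetaSeries (D : ThetaSeriesDatum Mp SX Xk) (Φ : SX) (S : Mp) : ℂ :=
  ∑' ξ : Xk, D.ev (D.act S Φ) ξ

/-- Unfolding of `thetaSeries`. [cite: Weil1964, Chap. III n° 41, Thm 6 p. 193] -/
theorem thetaSeries_def (D : ThetaSeriesDatum Mp SX Xk) (Φ : SX) (S : Mp) :
    D.thetaSeries Φ S = ∑' ξ : Xk, D.ev (D.act S Φ) ξ := rfl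

/-- The tree's `WeilThetaDatum` (carriers of `ThetaDistribution.lean`) of a theta-series datum, with `theta` Weil's
formula and `rat` the given subset `r_k(Ps(X)_k)`. [cite: Weil1964, Chap. III n° 41, Thm 6 p. 193] -/
noncomputable def toWeilThetaDatum (D : ThetaSeriesDatum Mp SX Xk) (rat : Set Mp) : WeilThetaDatum Mp SX where
  act := D.act
  rat := rat
  theta Φ S := D.thetaSeries Φ S

/-- Unfolding: the packaged `theta` is the theta series. [folklore] -/
@[simp] theorem toWeilThetaDatum_theta (D : ThetaSeriesDatum Mp SX Xk) (rat : Set Mp) (Φ : SX) (S : Mp) :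
    (D.toWeilThetaDatum rat).theta Φ S = D.thetaSeries Φ S := rfl

/-- Absolute convergence of the theta series of `Φ` at `S` (for `Φ ∈ S(X_A)` this is part of Weil's proof of Thm 6,
n° 41 Lemme 5; here a named hypothesis on the bare carriers). [cite: Weil1964, Chap. III n° 41, Lemme 5 p. 194] -/
def AbsSummableAt (D : ThetaSeriesDatum Mp SX Xk) (Φ : SX) (S : Mp) : Prop :=
  Summable fun ξ : Xk => ‖D.ev (D.act S Φ) ξ‖

end ThetaSeriesDatum

/-! ## The product formula over `X = X₁ ⊕ X₂` -/

section Product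

variable {Mp₁ Mp₂ Mp : Type u} {SX₁ SX₂ SX : Type v} {Xk₁ Xk₂ : Type w}

/-- **Theta series of pure tensors multiply.**  Let `X = X₁ ⊕ X₂`, so `X_k = X_{1,k} × X_{2,k}`; let `pair Φ₁ Φ₂`
be the pure tensor `Φ₁ ⊗ Φ₂ ∈ S(X_A)` (evaluating as the product, `hev`) and `jt S₁ S₂` an element of `Mp(X)_A`
acting on pure tensors factorwise (`hact`; [MoeglinVignerasWaldspurger1987, Chap. 2 II.1 Rem. (6)]: `ω_ψ ∘ j ≃
ω_{ψ,1} ⊠ ω_{ψ,2}`).  If the two factor series converge absolutely, then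
`Θ_{Φ₁⊗Φ₂}(j̃(S₁,S₂)) = Θ_{Φ₁}(S₁) · Θ_{Φ₂}(S₂)`. [folklore] -/
theorem ThetaSeriesDatum.thetaSeries_pair (D₁ : ThetaSeriesDatum Mp₁ SX₁ Xk₁) (D₂ : ThetaSeriesDatum Mp₂ SX₂ Xk₂)
    (D : ThetaSeriesDatum Mp SX (Xk₁ × Xk₂)) (pair : SX₁ → SX₂ → SX) (jt : Mp₁ → Mp₂ → Mp)
    (hev : ∀ (Ψ₁ : SX₁) (Ψ₂ : SX₂) (ξ : Xk₁ × Xk₂), D.ev (pair Ψ₁ Ψ₂) ξ = D₁.ev Ψ₁ ξ.1 * D₂.ev Ψ₂ ξ.2)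
    {S₁ : Mp₁} {S₂ : Mp₂} {Φ₁ : SX₁} {Φ₂ : SX₂}
    (hact : D.act (jt S₁ S₂) (pair Φ₁ Φ₂) = pair (D₁.act S₁ Φ₁) (D₂.act S₂ Φ₂))
    (h₁ : D₁.AbsSummableAt Φ₁ S₁) (h₂ : D₂.AbsSummableAt Φ₂ S₂) :
    D.thetaSeries (pair Φ₁ Φ₂) (jt S₁ S₂) = D₁.thetaSeries Φ₁ S₁ * D₂.thetaSeries Φ₂ S₂ := by
  simp only [ThetaSeriesDatum.thetaSeries, hact, hev]
  exact (tsum_mul_tsum_of_summable_norm h₁ h₂).symm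

/-- The same, stated for the packaged `WeilThetaDatum`s. [folklore] -/
theorem ThetaSeriesDatum.toWeilThetaDatum_theta_pair (D₁ : ThetaSeriesDatum Mp₁ SX₁ Xk₁)
    (D₂ : ThetaSeriesDatum Mp₂ SX₂ Xk₂) (D : ThetaSeriesDatum Mp SX (Xk₁ × Xk₂)) (rat₁ : Set Mp₁) (rat₂ : Set Mp₂)
    (rat : Set Mp) (pair : SX₁ → SX₂ → SX) (jt : Mp₁ → Mp₂ → Mp)
    (hev : ∀ (Ψ₁ : SX₁) (Ψ₂ : SX₂) (ξ : Xk₁ × Xk₂), D.ev (pair Ψ₁ Ψ₂) ξ = D₁.ev Ψ₁ ξ.1 * D₂.ev Ψ₂ ξ.2)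
    {S₁ : Mp₁} {S₂ : Mp₂} {Φ₁ : SX₁} {Φ₂ : SX₂}
    (hact : D.act (jt S₁ S₂) (pair Φ₁ Φ₂) = pair (D₁.act S₁ Φ₁) (D₂.act S₂ Φ₂))
    (h₁ : D₁.AbsSummableAt Φ₁ S₁) (h₂ : D₂.AbsSummableAt Φ₂ S₂) :
    (D.toWeilThetaDatum rat).theta (pair Φ₁ Φ₂) (jt S₁ S₂) =
      (D₁.toWeilThetaDatum rat₁).theta Φ₁ S₁ * (D₂.toWeilThetaDatum rat₂).theta Φ₂ S₂ := by
  simp only [ThetaSeriesDatum.toWeilThetaDatum_theta]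
  exact D₁.thetaSeries_pair D₂ D pair jt hev hact h₁ h₂

end Product

end Literature.NumberTheory.Weil1964
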